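import Summits.Ventures.LatticeQCDFlow.Exactness.IMHColdStartTwoTime
import Summits.Ventures.LatticeQCDFlow.Scoring.IndepMHKernelPositive
import HarnessLib

/-!
# The cold start, second order: the exact mean-square error of a cold-started flow-MCMC time average, against
# the stationary start

HONEST FRAMING: exact (Metropolis-corrected) sampling algorithms for lattice gauge theory;
figures of merit are autocorrelation/cost numbers at stated couplings and volumes; no
continuum-physics claim.

Venture `LatticeQCDFlow` (cell pub-lqcd), topic `Exactness`; FANOUT row 30 (lean-1, GEN-32).  NEW WORK of the
cell, general state space.  Setting of `IMHColdStartTwoTime` (this generation): `K = indepMH q w`, `w` normalised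
(`π = w·q`), maximal at `x₀`, `r = 1 − 1/w(x₀)`; `f` bounded measurable, `f̄ = f − π f`, `δ = f(x₀) − π f`,
`γ_u = autocov K π f̄ u = ∫ f̄·(K^u f̄) dπ` the stationary autocovariances, `V = γ_0 = Var_π f`,
`A_N = (1/N)Σ_{i<N} f(X_i)` the time average, `MSE_μ(N) = E_μ[(A_N − π f)²]` on path space (Mathlib
`Kernel.trajMeasure`).  The Scoring row certified, for EVERY Doeblin chain and EVERY start,
`MSE_{μ₀}(N) ≤ (2/ε − 1)V/N + 16 C'²/(ε²N²)` (`Scoring/ChainMeanSquareError`) and `N·MSE_{μ₀}(N) → σ²_f`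
(`Scoring/ChainMeanSquareErrorSharp`, "NOT CLAIMED: the `O(1/N²)` term's sharp constant").  For flow-MCMC from
the cold configuration the second-order term is computed here EXACTLY:

* §1 **`imh_chain_pair_mode`** — every pair moment: `E_{x₀}[f̄(X_i) f̄(X_j)] = (1 − r^{min(i,j)})·γ_{|i−j|} +
  r^{max(i,j)}·δ²` (the two-time law of `IMHColdStartTwoTime`, symmetrised).
* §2 **`imh_chain_mse_mode_eq`** — THE EXACT MEAN-SQUARE ERROR OF THE COLD-STARTED TIME AVERAGE:
  `N²·MSE_{x₀}(N) = Σ_{i,j<N} [(1 − r^{min(i,j)})·γ_{|i−j|} + r^{max(i,j)}·δ²]`;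
  **`chain_mse_stationary_eq`** — the stationary one, `N²·MSE_π(N) = Σ_{i,j<N} γ_{|i−j|}` (any Markov kernel with
  invariant `π`); hence **`imh_chain_mse_mode_sub_stationary`** — THE EXACT PRICE OF THE COLD START:
  `N²·(MSE_{x₀}(N) − MSE_π(N)) = δ²·P_N − Σ_{i,j<N} r^{min(i,j)}·γ_{|i−j|}`, `P_N = Σ_{k<N}(2k+1)r^k`
  (`= Σ_{i,j<N} r^{max(i,j)}`, the Scoring row's pair count `sum_sum_max`).
* §3 two-sided, from the tree's two structural facts about flow-MCMC autocovariances — POSITIVE at every lag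
  (`Scoring/IndepMHKernelPositive.indepMH_autocov_nonneg`) and under the envelope `γ_u ≤ r^u·V` with the EXACT
  Doeblin constant `1/w(x₀)` (`Scoring/DoeblinAutocorrelation.abs_autocov_le_of_doeblin` + `IMHKernel.indepMH_apply_ge`):
  **`imh_sum_sum_pow_min_autocov_bounds`** — `0 ≤ Σ_{i,j<N} r^{min}γ_{|i−j|} ≤ V·P_N` (`r^{min}·r^{|i−j|} = r^{max}`);
  hence **`imh_chain_mse_mode_two_sided`** —
  `(δ² − V)·P_N ≤ N²·(MSE_{x₀}(N) − MSE_π(N)) ≤ δ²·P_N`, and with `P_N ≤ (1 + r)/(1 − r)² = 2w(x₀)² − w(x₀)`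
  (**`oddPowSum_le_mode`**): **`imh_chain_mse_mode_le_stationary_add`** —
  `MSE_{x₀}(N) ≤ MSE_π(N) + (2w(x₀)² − w(x₀))·δ²/N²`, and **`imh_chain_mse_mode_ge_stationary_sub`** —
  `MSE_{x₀}(N) ≥ MSE_π(N) − (2w(x₀)² − w(x₀))·V/N²`: THE COLD START CHANGES THE MEAN-SQUARE ERROR ONLY AT SECOND
  ORDER, BY AT MOST `(2w(x₀)² − w(x₀))·max(δ², V)/N²` IN EITHER DIRECTION — and it can LOWER it (an observable with
  `f(x₀) = π f` has `δ = 0`: frozen at a point of zero error, the cold-started run fluctuates less than the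
  stationary one, exactly by `Σ r^{min}γ/N² ≥ 0`).
Reading (value-free; gauge files `Scaling/AutoregressiveGaugeColdStartMSE`): with `1/w(cold) = A = Z/(c^{#B}M^k)`
resp. `Z/∏_ℓ c_{#C_ℓ}`, a cold-started exact gauge sampler's time average has mean-square error within
`(2/A² − 1/A)·max(δf², Var_π f)/N²` of the equilibrium run's: after `N ≫ 1/A` steps the cold start is free to second
order (the bias floor `δf²/(1 + N·A)²` and replicas: `IMHColdStartReplicas`).  NOT CLAIMED: the limit
`N²(MSE_{x₀} − MSE_π) → (2w² − w)δ² − w·σ²_f` (needs the summed autocovariances; not taken here); non-modal starts;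
unbounded `f`.

No `sorry`, no new definitions, nothing cited as a fact; general measurable space with measurable singletons.
-/

noncomputable section

namespace Summit.Ventures.LatticeQCDFlow.Exactness

open MeasureTheory ProbabilityTheory Function Finset
open scoped ENNReal
open Summit.Ventures.LatticeQCDFlow.Scoring

variable {Ω : Type*} [MeasurableSpace Ω] [MeasurableSingletonClass Ω]
variable {q : Measure Ω} [IsProbabilityMeasure q] {w : Ω → ℝ}

/-! ## §0 Bookkeeping: the centred observable, the weight is integrable -/

omit [MeasurableSingletonClass Ω] [IsProbabilityMeasure q] in
/-- The centred observable `f − π f` is bounded measurable with `π`-mean zero. [ours, bookkeeping] -/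
theorem centred_facts [IsProbabilityMeasure (q.withDensity fun y => ENNReal.ofReal (w y))]
    {f : Ω → ℝ} (hf : Measurable f) {C : ℝ} (hC : ∀ x, |f x| ≤ C) :
    Measurable (fun x => f x - ∫ z, f z ∂(q.withDensity fun y => ENNReal.ofReal (w y))) ∧
    (∀ x, |f x - ∫ z, f z ∂(q.withDensity fun y => ENNReal.ofReal (w y))| ≤
      C + |∫ z, f z ∂(q.withDensity fun y => ENNReal.ofReal (w y))|) ∧
    ∫ x, (f x - ∫ z, f z ∂(q.withDensity fun y => ENNReal.ofReal (w y)))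
      ∂(q.withDensity fun y => ENNReal.ofReal (w y)) = 0 := by
  refine ⟨hf.sub measurable_const, fun x => (abs_sub _ _).trans (add_le_add (hC x) le_rfl), ?_⟩
  rw [integral_sub (integrable_of_bounded _ hf hC) (integrable_const _), integral_const, probReal_univ,
    one_smul, sub_self]

omit [MeasurableSingletonClass Ω] [IsProbabilityMeasure q] in
/-- A normalised positive measurable weight is `q`-integrable (`∫ w dq = 1`). [ours, bookkeeping] -/
theorem integrable_weight_of_normalised (hw : Measurable w) (hw0 : ∀ y, 0 < w y)
    [IsProbabilityMeasure (q.withDensity fun y => ENNReal.ofReal (w y))] : Integrable w q := by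
  have hlin : ∫⁻ x, ENNReal.ofReal (w x) ∂q = 1 := by
    have h : (q.withDensity fun y => ENNReal.ofReal (w y)) Set.univ = 1 := measure_univ
    rwa [withDensity_apply _ MeasurableSet.univ, Measure.restrict_univ] at h
  refine ⟨hw.aestronglyMeasurable, ?_⟩
  show ∫⁻ x, ‖w x‖ₑ ∂q < ⊤
  simp_rw [Real.enorm_eq_ofReal (hw0 _).le]
  rw [hlin]
  exact ENNReal.one_lt_top

/-! ## §1 Every pair moment of the cold-started chain -/

/-- **`E_{x₀}[f̄(X_i) f̄(X_j)] = (1 − r^{min(i,j)})·γ_{|i−j|} + r^{max(i,j)}·δ²`** for the centred observable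
`f̄ = f − π f` (`γ_u = autocov K π f̄ u`, `δ = f(x₀) − π f`). [ours] -/
theorem imh_chain_pair_mode [Fact (Measurable w)] (hw0 : ∀ y, 0 < w y) {x₀ : Ω} (hmax : ∀ y, w y ≤ w x₀)
    [IsProbabilityMeasure (q.withDensity fun y => ENNReal.ofReal (w y))]
    {f : Ω → ℝ} (hf : Measurable f) {C : ℝ} (hC : ∀ x, |f x| ≤ C) (i j : ℕ) :
    ∫ x, (f (x i) - ∫ z, f z ∂(q.withDensity fun y => ENNReal.ofReal (w y))) *
        (f (x j) - ∫ z, f z ∂(q.withDensity fun y => ENNReal.ofReal (w y)))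
        ∂(Kernel.trajMeasure (X := fun _ : ℕ => Ω) (Measure.dirac x₀)
          (fun n : ℕ => (indepMH q w).comap (fun h : (i : ↥(Finset.Iic n)) → Ω => h ⟨n, Finset.mem_Iic.2 le_rfl⟩)
            (measurable_pi_apply _))) =
      (1 - (1 - (w x₀)⁻¹) ^ min i j) *
          autocov (indepMH q w) (q.withDensity fun y => ENNReal.ofReal (w y))
            (fun x => f x - ∫ z, f z ∂(q.withDensity fun y => ENNReal.ofReal (w y))) (Nat.dist i j) +
        (1 - (w x₀)⁻¹) ^ max i j *
          (f x₀ - ∫ z, f z ∂(q.withDensity fun y => ENNReal.ofReal (w y))) ^ 2 := by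
  obtain ⟨hgm, hgb, hg0⟩ := centred_facts (q := q) (w := w) hf hC
  rcases le_total i j with hij | hji
  · obtain ⟨u, rfl⟩ := Nat.exists_eq_add_of_le hij
    rw [imh_chain_twoTime_mode_of_centred hw0 hmax hgm hgb hgm hgb hg0 i u, min_eq_left hij, max_eq_right hij,
      Nat.dist_eq_sub_of_le hij, Nat.add_sub_cancel_left, autocov, sq]
  · obtain ⟨u, rfl⟩ := Nat.exists_eq_add_of_le hji
    rw [min_eq_right hji, max_eq_left hji, Nat.dist_eq_sub_of_le_right hji, Nat.add_sub_cancel_left, autocov, sq,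
      ← imh_chain_twoTime_mode_of_centred hw0 hmax hgm hgb hgm hgb hg0 j u]
    exact integral_congr_ae (ae_of_all _ fun x => mul_comm _ _)

/-! ## §2 The exact mean-square error, and the stationary one -/

/-- **THE EXACT MEAN-SQUARE ERROR OF THE COLD-STARTED TIME AVERAGE**: for `N ≥ 1`,
`E_{x₀}[(A_N − π f)²] = (1/N²)·Σ_{i,j<N} [(1 − r^{min(i,j)})·γ_{|i−j|} + r^{max(i,j)}·δ²]`. [ours] -/
theorem imh_chain_mse_mode_eq [Fact (Measurable w)] (hw0 : ∀ y, 0 < w y) {x₀ : Ω} (hmax : ∀ y, w y ≤ w x₀)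
    [IsProbabilityMeasure (q.withDensity fun y => ENNReal.ofReal (w y))]
    {f : Ω → ℝ} (hf : Measurable f) {C : ℝ} (hC : ∀ x, |f x| ≤ C) {N : ℕ} (hN : N ≠ 0) :
    ∫ x, ((∑ i ∈ Finset.range N, f (x i)) / N - ∫ z, f z ∂(q.withDensity fun y => ENNReal.ofReal (w y))) ^ 2
        ∂(Kernel.trajMeasure (X := fun _ : ℕ => Ω) (Measure.dirac x₀)
          (fun n : ℕ => (indepMH q w).comap (fun h : (i : ↥(Finset.Iic n)) → Ω => h ⟨n, Finset.mem_Iic.2 le_rfl⟩)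
            (measurable_pi_apply _))) =
      (∑ i ∈ Finset.range N, ∑ j ∈ Finset.range N,
          ((1 - (1 - (w x₀)⁻¹) ^ min i j) *
              autocov (indepMH q w) (q.withDensity fun y => ENNReal.ofReal (w y))
                (fun x => f x - ∫ z, f z ∂(q.withDensity fun y => ENNReal.ofReal (w y))) (Nat.dist i j) +
            (1 - (w x₀)⁻¹) ^ max i j *
              (f x₀ - ∫ z, f z ∂(q.withDensity fun y => ENNReal.ofReal (w y))) ^ 2)) / (N : ℝ) ^ 2 := by
  rw [chain_sqError_timeAverage_eq hf hC _ hN]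
  congr 1
  refine sum_congr rfl fun i _ => sum_congr rfl fun j _ => ?_
  exact imh_chain_pair_mode hw0 hmax hf hC i j

omit [MeasurableSingletonClass Ω] [IsProbabilityMeasure q] in
/-- **The stationary mean-square error** of a time average, for ANY Markov kernel with an invariant probability
law `π` and `N ≥ 1`: `E_π[(A_N − π f)²] = (1/N²)·Σ_{i,j<N} γ_{|i−j|}`, `γ_u = autocov κ π (f − π f) u`. [ours,
bookkeeping on the Scoring row's `chain_sqError_timeAverage_eq` and `chain_autocov`] -/
theorem chain_mse_stationary_eq (κ : Kernel Ω Ω) [IsMarkovKernel κ] {π : Measure Ω} [IsProbabilityMeasure π]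
    (hπ : Kernel.Invariant κ π) {f : Ω → ℝ} (hf : Measurable f) {C : ℝ} (hC : ∀ x, |f x| ≤ C) {N : ℕ}
    (hN : N ≠ 0) :
    ∫ x, ((∑ i ∈ Finset.range N, f (x i)) / N - ∫ z, f z ∂π) ^ 2
        ∂(Kernel.trajMeasure (X := fun _ : ℕ => Ω) π
          (fun n : ℕ => κ.comap (fun h : (i : ↥(Finset.Iic n)) → Ω => h ⟨n, Finset.mem_Iic.2 le_rfl⟩)
            (measurable_pi_apply _))) =
      (∑ i ∈ Finset.range N, ∑ j ∈ Finset.range N,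
          autocov κ π (fun x => f x - ∫ z, f z ∂π) (Nat.dist i j)) / (N : ℝ) ^ 2 := by
  have hgm : Measurable (fun x => f x - ∫ z, f z ∂π) := hf.sub measurable_const
  have hgb : ∀ x, |f x - ∫ z, f z ∂π| ≤ C + |∫ z, f z ∂π| :=
    fun x => (abs_sub _ _).trans (add_le_add (hC x) le_rfl)
  rw [chain_sqError_timeAverage_eq hf hC _ hN]
  congr 1
  refine sum_congr rfl fun i _ => sum_congr rfl fun j _ => ?_
  rcases le_total i j with hij | hji
  · obtain ⟨u, rfl⟩ := Nat.exists_eq_add_of_le hij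
    rw [Nat.dist_eq_sub_of_le hij, Nat.add_sub_cancel_left]
    exact chain_autocov hπ hgm hgb i u
  · obtain ⟨u, rfl⟩ := Nat.exists_eq_add_of_le hji
    rw [Nat.dist_eq_sub_of_le_right hji, Nat.add_sub_cancel_left, ← chain_autocov hπ hgm hgb j u]
    exact integral_congr_ae (ae_of_all _ fun x => mul_comm _ _)

omit [MeasurableSingletonClass Ω] [IsProbabilityMeasure q] in
/-- Splitting the cold-start double sum: `Σ_{i,j} [(1 − r^{min})γ + r^{max}δ²] = Σ_{i,j} γ − Σ_{i,j} r^{min}γ +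
δ²·Σ_{k<N}(2k+1)r^k`. [ours, bookkeeping] -/
theorem sum_sum_coldStart_split (r δ : ℝ) (γ : ℕ → ℝ) (N : ℕ) :
    ∑ i ∈ Finset.range N, ∑ j ∈ Finset.range N,
        ((1 - r ^ min i j) * γ (Nat.dist i j) + r ^ max i j * δ ^ 2) =
      ∑ i ∈ Finset.range N, ∑ j ∈ Finset.range N, γ (Nat.dist i j) -
        ∑ i ∈ Finset.range N, ∑ j ∈ Finset.range N, r ^ min i j * γ (Nat.dist i j) +
          δ ^ 2 * ∑ k ∈ Finset.range N, (2 * (k : ℝ) + 1) * r ^ k := by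
  rw [← sum_sum_max (fun k => r ^ k) N, mul_sum, ← sum_sub_distrib, ← sum_add_distrib]
  refine sum_congr rfl fun i _ => ?_
  rw [mul_sum, ← sum_sub_distrib, ← sum_add_distrib]
  refine sum_congr rfl fun j _ => ?_
  ring

/-- **THE EXACT PRICE OF THE COLD START**: `N ≥ 1` ⇒
`N²·(MSE_{x₀}(N) − MSE_π(N)) = δ²·Σ_{k<N}(2k+1)r^k − Σ_{i,j<N} r^{min(i,j)}·γ_{|i−j|}`. [ours] -/
theorem imh_chain_mse_mode_sub_stationary [Fact (Measurable w)] (hw0 : ∀ y, 0 < w y) {x₀ : Ω}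
    (hmax : ∀ y, w y ≤ w x₀) [IsProbabilityMeasure (q.withDensity fun y => ENNReal.ofReal (w y))]
    {f : Ω → ℝ} (hf : Measurable f) {C : ℝ} (hC : ∀ x, |f x| ≤ C) {N : ℕ} (hN : N ≠ 0) :
    (N : ℝ) ^ 2 *
        (∫ x, ((∑ i ∈ Finset.range N, f (x i)) / N - ∫ z, f z ∂(q.withDensity fun y => ENNReal.ofReal (w y))) ^ 2
            ∂(Kernel.trajMeasure (X := fun _ : ℕ => Ω) (Measure.dirac x₀)
              (fun n : ℕ => (indepMH q w).comap (fun h : (i : ↥(Finset.Iic n)) → Ω => h ⟨n, Finset.mem_Iic.2 le_rfl⟩)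
                (measurable_pi_apply _))) -
          ∫ x, ((∑ i ∈ Finset.range N, f (x i)) / N - ∫ z, f z ∂(q.withDensity fun y => ENNReal.ofReal (w y))) ^ 2
            ∂(Kernel.trajMeasure (X := fun _ : ℕ => Ω) (q.withDensity fun y => ENNReal.ofReal (w y))
              (fun n : ℕ => (indepMH q w).comap (fun h : (i : ↥(Finset.Iic n)) → Ω => h ⟨n, Finset.mem_Iic.2 le_rfl⟩)
                (measurable_pi_apply _)))) =
      (f x₀ - ∫ z, f z ∂(q.withDensity fun y => ENNReal.ofReal (w y))) ^ 2 *
          ∑ k ∈ Finset.range N, (2 * (k : ℝ) + 1) * (1 - (w x₀)⁻¹) ^ k -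
        ∑ i ∈ Finset.range N, ∑ j ∈ Finset.range N, (1 - (w x₀)⁻¹) ^ min i j *
          autocov (indepMH q w) (q.withDensity fun y => ENNReal.ofReal (w y))
            (fun x => f x - ∫ z, f z ∂(q.withDensity fun y => ENNReal.ofReal (w y))) (Nat.dist i j) := by
  have hNpos : (0 : ℝ) < N := by exact_mod_cast Nat.pos_of_ne_zero hN
  have hN2 : (N : ℝ) ^ 2 ≠ 0 := pow_ne_zero 2 hNpos.ne'
  have hπ : Kernel.Invariant (indepMH q w) (q.withDensity fun y => ENNReal.ofReal (w y)) :=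
    indepMH_invariant (q := q) Fact.out hw0
  rw [imh_chain_mse_mode_eq hw0 hmax hf hC hN, chain_mse_stationary_eq (indepMH q w) hπ hf hC hN,
    sum_sum_coldStart_split, ← sub_div, mul_div_cancel₀ _ hN2]
  ring

/-! ## §3 Two-sided: positivity and the envelope of flow-MCMC autocovariances -/

omit [MeasurableSingletonClass Ω] in
/-- The two structural facts, instantiated: for the centred bounded observable `f̄` and every lag `u`,
`0 ≤ γ_u ≤ r^u·V` (`V = γ_0 = ∫ f̄² dπ`), `r = 1 − 1/w(x₀)` the exact Doeblin rate at a mode. [ours, on the tree's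
`indepMH_autocov_nonneg` and `abs_autocov_le_of_doeblin`] -/
theorem imh_autocov_centred_bounds (hw : Measurable w) (hw0 : ∀ y, 0 < w y) {x₀ : Ω} (hmax : ∀ y, w y ≤ w x₀)
    [IsProbabilityMeasure (q.withDensity fun y => ENNReal.ofReal (w y))]
    {f : Ω → ℝ} (hf : Measurable f) {C : ℝ} (hC : ∀ x, |f x| ≤ C) (u : ℕ) :
    0 ≤ autocov (indepMH q w) (q.withDensity fun y => ENNReal.ofReal (w y))
        (fun x => f x - ∫ z, f z ∂(q.withDensity fun y => ENNReal.ofReal (w y))) u ∧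
      autocov (indepMH q w) (q.withDensity fun y => ENNReal.ofReal (w y))
          (fun x => f x - ∫ z, f z ∂(q.withDensity fun y => ENNReal.ofReal (w y))) u ≤
        (1 - (w x₀)⁻¹) ^ u *
          ∫ x, (f x - ∫ z, f z ∂(q.withDensity fun y => ENNReal.ofReal (w y))) ^ 2
            ∂(q.withDensity fun y => ENNReal.ofReal (w y)) := by
  haveI : Fact (Measurable w) := ⟨hw⟩
  obtain ⟨hgm, hgb, hg0⟩ := centred_facts (q := q) (w := w) hf hC
  have hWpos : 0 < w x₀ := hw0 x₀
  refine ⟨indepMH_autocov_nonneg hw hw0 (integrable_weight_of_normalised hw hw0) rfl hgm hgb u, ?_⟩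
  have hmin : ∀ x {B : Set Ω}, MeasurableSet B →
      (ENNReal.ofReal (w x₀))⁻¹ * (q.withDensity fun y => ENNReal.ofReal (w y)) B ≤ indepMH q w x B :=
    fun x B hB => indepMH_apply_ge hw hw0 hmax x hB
  have h := abs_autocov_le_of_doeblin (indepMH_invariant (q := q) hw hw0) hmin hgm hgb hg0 u
  have htoReal : ((ENNReal.ofReal (w x₀))⁻¹).toReal = (w x₀)⁻¹ := by
    rw [ENNReal.toReal_inv, ENNReal.toReal_ofReal hWpos.le]
  rw [htoReal] at h
  exact (le_abs_self _).trans h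

omit [MeasurableSingletonClass Ω] in
/-- **`0 ≤ Σ_{i,j<N} r^{min(i,j)}·γ_{|i−j|} ≤ V·Σ_{k<N}(2k+1)r^k`** (`r^{min}·r^{|i−j|} = r^{max}` and the pair count by
the larger index). [ours] -/
theorem imh_sum_sum_pow_min_autocov_bounds (hw : Measurable w) (hw0 : ∀ y, 0 < w y) {x₀ : Ω}
    (hmax : ∀ y, w y ≤ w x₀) [IsProbabilityMeasure (q.withDensity fun y => ENNReal.ofReal (w y))]
    {f : Ω → ℝ} (hf : Measurable f) {C : ℝ} (hC : ∀ x, |f x| ≤ C) (N : ℕ) :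
    0 ≤ ∑ i ∈ Finset.range N, ∑ j ∈ Finset.range N, (1 - (w x₀)⁻¹) ^ min i j *
          autocov (indepMH q w) (q.withDensity fun y => ENNReal.ofReal (w y))
            (fun x => f x - ∫ z, f z ∂(q.withDensity fun y => ENNReal.ofReal (w y))) (Nat.dist i j) ∧
      ∑ i ∈ Finset.range N, ∑ j ∈ Finset.range N, (1 - (w x₀)⁻¹) ^ min i j *
          autocov (indepMH q w) (q.withDensity fun y => ENNReal.ofReal (w y))
            (fun x => f x - ∫ z, f z ∂(q.withDensity fun y => ENNReal.ofReal (w y))) (Nat.dist i j) ≤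
        (∫ x, (f x - ∫ z, f z ∂(q.withDensity fun y => ENNReal.ofReal (w y))) ^ 2
            ∂(q.withDensity fun y => ENNReal.ofReal (w y))) *
          ∑ k ∈ Finset.range N, (2 * (k : ℝ) + 1) * (1 - (w x₀)⁻¹) ^ k := by
  have hW : 1 ≤ w x₀ := one_le_of_mode (q := q) hmax
  have hr0 : 0 ≤ 1 - (w x₀)⁻¹ := sub_nonneg.2 (inv_le_one_of_one_le₀ hW)
  have hb := fun u => imh_autocov_centred_bounds (q := q) hw hw0 hmax hf hC u
  refine ⟨sum_nonneg fun i _ => sum_nonneg fun j _ => mul_nonneg (pow_nonneg hr0 _) (hb _).1, ?_⟩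
  rw [← sum_sum_max (fun k => (1 - (w x₀)⁻¹) ^ k) N, mul_sum]
  refine sum_le_sum fun i _ => ?_
  rw [mul_sum]
  refine sum_le_sum fun j _ => ?_
  have hmax' : max i j = min i j + Nat.dist i j := by
    rcases le_total i j with hij | hji
    · rw [max_eq_right hij, min_eq_left hij, Nat.dist_eq_sub_of_le hij, Nat.add_sub_cancel' hij]
    · rw [max_eq_left hji, min_eq_right hji, Nat.dist_eq_sub_of_le_right hji, Nat.add_sub_cancel' hji]
  calc (1 - (w x₀)⁻¹) ^ min i j *
        autocov (indepMH q w) (q.withDensity fun y => ENNReal.ofReal (w y))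
          (fun x => f x - ∫ z, f z ∂(q.withDensity fun y => ENNReal.ofReal (w y))) (Nat.dist i j)
      ≤ (1 - (w x₀)⁻¹) ^ min i j * ((1 - (w x₀)⁻¹) ^ Nat.dist i j *
          ∫ x, (f x - ∫ z, f z ∂(q.withDensity fun y => ENNReal.ofReal (w y))) ^ 2
            ∂(q.withDensity fun y => ENNReal.ofReal (w y))) :=
        mul_le_mul_of_nonneg_left (hb _).2 (pow_nonneg hr0 _)
    _ = (∫ x, (f x - ∫ z, f z ∂(q.withDensity fun y => ENNReal.ofReal (w y))) ^ 2
            ∂(q.withDensity fun y => ENNReal.ofReal (w y))) * (1 - (w x₀)⁻¹) ^ max i j := by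
        rw [hmax', pow_add]; ring

/-- **TWO-SIDED**: `(δ² − V)·P_N ≤ N²·(MSE_{x₀}(N) − MSE_π(N)) ≤ δ²·P_N`, `P_N = Σ_{k<N}(2k+1)r^k`, `N ≥ 1`. [ours] -/
theorem imh_chain_mse_mode_two_sided [Fact (Measurable w)] (hw0 : ∀ y, 0 < w y) {x₀ : Ω}
    (hmax : ∀ y, w y ≤ w x₀) [IsProbabilityMeasure (q.withDensity fun y => ENNReal.ofReal (w y))]
    {f : Ω → ℝ} (hf : Measurable f) {C : ℝ} (hC : ∀ x, |f x| ≤ C) {N : ℕ} (hN : N ≠ 0) :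
    ((f x₀ - ∫ z, f z ∂(q.withDensity fun y => ENNReal.ofReal (w y))) ^ 2 -
          ∫ x, (f x - ∫ z, f z ∂(q.withDensity fun y => ENNReal.ofReal (w y))) ^ 2
            ∂(q.withDensity fun y => ENNReal.ofReal (w y))) *
        ∑ k ∈ Finset.range N, (2 * (k : ℝ) + 1) * (1 - (w x₀)⁻¹) ^ k ≤
      (N : ℝ) ^ 2 *
        (∫ x, ((∑ i ∈ Finset.range N, f (x i)) / N - ∫ z, f z ∂(q.withDensity fun y => ENNReal.ofReal (w y))) ^ 2
            ∂(Kernel.trajMeasure (X := fun _ : ℕ => Ω) (Measure.dirac x₀)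
              (fun n : ℕ => (indepMH q w).comap (fun h : (i : ↥(Finset.Iic n)) → Ω => h ⟨n, Finset.mem_Iic.2 le_rfl⟩)
                (measurable_pi_apply _))) -
          ∫ x, ((∑ i ∈ Finset.range N, f (x i)) / N - ∫ z, f z ∂(q.withDensity fun y => ENNReal.ofReal (w y))) ^ 2
            ∂(Kernel.trajMeasure (X := fun _ : ℕ => Ω) (q.withDensity fun y => ENNReal.ofReal (w y))
              (fun n : ℕ => (indepMH q w).comap (fun h : (i : ↥(Finset.Iic n)) → Ω => h ⟨n, Finset.mem_Iic.2 le_rfl⟩)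
                (measurable_pi_apply _)))) ∧
    (N : ℝ) ^ 2 *
        (∫ x, ((∑ i ∈ Finset.range N, f (x i)) / N - ∫ z, f z ∂(q.withDensity fun y => ENNReal.ofReal (w y))) ^ 2
            ∂(Kernel.trajMeasure (X := fun _ : ℕ => Ω) (Measure.dirac x₀)
              (fun n : ℕ => (indepMH q w).comap (fun h : (i : ↥(Finset.Iic n)) → Ω => h ⟨n, Finset.mem_Iic.2 le_rfl⟩)
                (measurable_pi_apply _))) -
          ∫ x, ((∑ i ∈ Finset.range N, f (x i)) / N - ∫ z, f z ∂(q.withDensity fun y => ENNReal.ofReal (w y))) ^ 2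
            ∂(Kernel.trajMeasure (X := fun _ : ℕ => Ω) (q.withDensity fun y => ENNReal.ofReal (w y))
              (fun n : ℕ => (indepMH q w).comap (fun h : (i : ↥(Finset.Iic n)) → Ω => h ⟨n, Finset.mem_Iic.2 le_rfl⟩)
                (measurable_pi_apply _)))) ≤
      (f x₀ - ∫ z, f z ∂(q.withDensity fun y => ENNReal.ofReal (w y))) ^ 2 *
        ∑ k ∈ Finset.range N, (2 * (k : ℝ) + 1) * (1 - (w x₀)⁻¹) ^ k := by
  obtain ⟨h0, h1⟩ := imh_sum_sum_pow_min_autocov_bounds (q := q) Fact.out hw0 hmax hf hC N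
  rw [imh_chain_mse_mode_sub_stationary hw0 hmax hf hC hN]
  constructor
  · rw [sub_mul]; linarith
  · linarith

omit [MeasurableSingletonClass Ω] in
/-- `P_N = Σ_{k<N}(2k+1)r^k ≤ (1 + r)/(1 − r)² = 2w(x₀)² − w(x₀)` at a mode of a normalised weight. [ours] -/
theorem oddPowSum_le_mode (hw0 : ∀ y, 0 < w y) {x₀ : Ω} (hmax : ∀ y, w y ≤ w x₀)
    [IsProbabilityMeasure (q.withDensity fun y => ENNReal.ofReal (w y))] (N : ℕ) :
    ∑ k ∈ Finset.range N, (2 * (k : ℝ) + 1) * (1 - (w x₀)⁻¹) ^ k ≤ 2 * w x₀ ^ 2 - w x₀ := by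
  have hW : 1 ≤ w x₀ := one_le_of_mode (q := q) hmax
  have hWpos : 0 < w x₀ := hw0 x₀
  have hr0 : 0 ≤ 1 - (w x₀)⁻¹ := sub_nonneg.2 (inv_le_one_of_one_le₀ hW)
  have hr1 : 1 - (w x₀)⁻¹ < 1 := sub_lt_self _ (inv_pos.2 hWpos)
  refine (sum_range_odd_mul_pow_le hr0 hr1 N).trans_eq ?_
  field_simp
  ring

/-- **THE COLD START COSTS AT MOST `(2w(x₀)² − w(x₀))·δ²/N²` ON TOP OF THE STATIONARY MEAN-SQUARE ERROR** (`N ≥ 1`).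
[ours] -/
theorem imh_chain_mse_mode_le_stationary_add [Fact (Measurable w)] (hw0 : ∀ y, 0 < w y) {x₀ : Ω}
    (hmax : ∀ y, w y ≤ w x₀) [IsProbabilityMeasure (q.withDensity fun y => ENNReal.ofReal (w y))]
    {f : Ω → ℝ} (hf : Measurable f) {C : ℝ} (hC : ∀ x, |f x| ≤ C) {N : ℕ} (hN : N ≠ 0) :
    ∫ x, ((∑ i ∈ Finset.range N, f (x i)) / N - ∫ z, f z ∂(q.withDensity fun y => ENNReal.ofReal (w y))) ^ 2
        ∂(Kernel.trajMeasure (X := fun _ : ℕ => Ω) (Measure.dirac x₀)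
          (fun n : ℕ => (indepMH q w).comap (fun h : (i : ↥(Finset.Iic n)) → Ω => h ⟨n, Finset.mem_Iic.2 le_rfl⟩)
            (measurable_pi_apply _))) ≤
      ∫ x, ((∑ i ∈ Finset.range N, f (x i)) / N - ∫ z, f z ∂(q.withDensity fun y => ENNReal.ofReal (w y))) ^ 2
          ∂(Kernel.trajMeasure (X := fun _ : ℕ => Ω) (q.withDensity fun y => ENNReal.ofReal (w y))
            (fun n : ℕ => (indepMH q w).comap (fun h : (i : ↥(Finset.Iic n)) → Ω => h ⟨n, Finset.mem_Iic.2 le_rfl⟩)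
              (measurable_pi_apply _))) +
        (2 * w x₀ ^ 2 - w x₀) * (f x₀ - ∫ z, f z ∂(q.withDensity fun y => ENNReal.ofReal (w y))) ^ 2 /
          (N : ℝ) ^ 2 := by
  set MSE₀ := ∫ x, ((∑ i ∈ Finset.range N, f (x i)) / N - ∫ z, f z ∂(q.withDensity fun y => ENNReal.ofReal (w y))) ^ 2
        ∂(Kernel.trajMeasure (X := fun _ : ℕ => Ω) (Measure.dirac x₀)
          (fun n : ℕ => (indepMH q w).comap (fun h : (i : ↥(Finset.Iic n)) → Ω => h ⟨n, Finset.mem_Iic.2 le_rfl⟩)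
            (measurable_pi_apply _))) with hMSE₀
  set MSEπ := ∫ x, ((∑ i ∈ Finset.range N, f (x i)) / N - ∫ z, f z ∂(q.withDensity fun y => ENNReal.ofReal (w y))) ^ 2
          ∂(Kernel.trajMeasure (X := fun _ : ℕ => Ω) (q.withDensity fun y => ENNReal.ofReal (w y))
            (fun n : ℕ => (indepMH q w).comap (fun h : (i : ↥(Finset.Iic n)) → Ω => h ⟨n, Finset.mem_Iic.2 le_rfl⟩)
              (measurable_pi_apply _))) with hMSEπ
  set δ := f x₀ - ∫ z, f z ∂(q.withDensity fun y => ENNReal.ofReal (w y)) with hδdef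
  have hNpos : (0 : ℝ) < N := by exact_mod_cast Nat.pos_of_ne_zero hN
  have hN2 : (0 : ℝ) < (N : ℝ) ^ 2 := pow_pos hNpos 2
  obtain ⟨-, h1⟩ := imh_chain_mse_mode_two_sided (q := q) hw0 hmax hf hC hN (x₀ := x₀)
  have hP := oddPowSum_le_mode (q := q) hw0 hmax N (x₀ := x₀)
  have hδ : 0 ≤ δ ^ 2 := sq_nonneg _
  have h2 := mul_le_mul_of_nonneg_left hP hδ
  have h3 : MSE₀ - MSEπ ≤ (2 * w x₀ ^ 2 - w x₀) * δ ^ 2 / (N : ℝ) ^ 2 := by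
    rw [le_div_iff₀ hN2]
    nlinarith [h1, h2]
  linarith

/-- **… AND IT CAN LOWER IT BY AT MOST `(2w(x₀)² − w(x₀))·Var_π f/N²`**: `MSE_{x₀}(N) ≥ MSE_π(N) −
(2w(x₀)² − w(x₀))·V/N²` (`N ≥ 1`). [ours] -/
theorem imh_chain_mse_mode_ge_stationary_sub [Fact (Measurable w)] (hw0 : ∀ y, 0 < w y) {x₀ : Ω}
    (hmax : ∀ y, w y ≤ w x₀) [IsProbabilityMeasure (q.withDensity fun y => ENNReal.ofReal (w y))]
    {f : Ω → ℝ} (hf : Measurable f) {C : ℝ} (hC : ∀ x, |f x| ≤ C) {N : ℕ} (hN : N ≠ 0) :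
    ∫ x, ((∑ i ∈ Finset.range N, f (x i)) / N - ∫ z, f z ∂(q.withDensity fun y => ENNReal.ofReal (w y))) ^ 2
          ∂(Kernel.trajMeasure (X := fun _ : ℕ => Ω) (q.withDensity fun y => ENNReal.ofReal (w y))
            (fun n : ℕ => (indepMH q w).comap (fun h : (i : ↥(Finset.Iic n)) → Ω => h ⟨n, Finset.mem_Iic.2 le_rfl⟩)
              (measurable_pi_apply _))) -
        (2 * w x₀ ^ 2 - w x₀) *
          (∫ x, (f x - ∫ z, f z ∂(q.withDensity fun y => ENNReal.ofReal (w y))) ^ 2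
            ∂(q.withDensity fun y => ENNReal.ofReal (w y))) / (N : ℝ) ^ 2 ≤
      ∫ x, ((∑ i ∈ Finset.range N, f (x i)) / N - ∫ z, f z ∂(q.withDensity fun y => ENNReal.ofReal (w y))) ^ 2
        ∂(Kernel.trajMeasure (X := fun _ : ℕ => Ω) (Measure.dirac x₀)
          (fun n : ℕ => (indepMH q w).comap (fun h : (i : ↥(Finset.Iic n)) → Ω => h ⟨n, Finset.mem_Iic.2 le_rfl⟩)
            (measurable_pi_apply _))) := by
  have hNpos : (0 : ℝ) < N := by exact_mod_cast Nat.pos_of_ne_zero hN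
  have hN2 : (0 : ℝ) < (N : ℝ) ^ 2 := pow_pos hNpos 2
  have hW : 1 ≤ w x₀ := one_le_of_mode (q := q) hmax
  have hr0 : 0 ≤ 1 - (w x₀)⁻¹ := sub_nonneg.2 (inv_le_one_of_one_le₀ hW)
  obtain ⟨h0, -⟩ := imh_chain_mse_mode_two_sided (q := q) hw0 hmax hf hC hN (x₀ := x₀)
  have hP := oddPowSum_le_mode (q := q) hw0 hmax N (x₀ := x₀)
  have hP0 : 0 ≤ ∑ k ∈ Finset.range N, (2 * (k : ℝ) + 1) * (1 - (w x₀)⁻¹) ^ k :=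
    sum_nonneg fun k _ => mul_nonneg (by positivity) (pow_nonneg hr0 k)
  have hV : 0 ≤ ∫ x, (f x - ∫ z, f z ∂(q.withDensity fun y => ENNReal.ofReal (w y))) ^ 2
      ∂(q.withDensity fun y => ENNReal.ofReal (w y)) := integral_nonneg fun x => sq_nonneg _
  have hδ : 0 ≤ (f x₀ - ∫ z, f z ∂(q.withDensity fun y => ENNReal.ofReal (w y))) ^ 2 := sq_nonneg _
  have h2 := mul_le_mul_of_nonneg_left hP hV
  have h3 := mul_nonneg hδ hP0
  rw [sub_le_iff_le_add, ← sub_le_iff_le_add', le_div_iff₀ hN2]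
  nlinarith [h0, h2, h3]

end Summit.Ventures.LatticeQCDFlow.Exactness
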